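import Summits.BirchSwinnertonDyer.BirchSwinnertonDyer.Theorems.PrintCf2RamifiedOffTYZMoverBlockFormSixOfValue
import Summits.BirchSwinnertonDyer.BirchSwinnertonDyer.Theorems.PrintCf2RamifiedOffTYZMoverSumBlocksSix
import HarnessLib

/-!
# Crux `PrintCf2.RamifiedOffTYZOfFacts` (stmt-BirchSwinnertonDyer-20509), line `offtyz-v7`, LEAD cycle 14 (cruxlead-20509 g13):
# THE EVEN BLOCK SUM WITHOUT THE GENUS REGIME — the Kummer block motion IS the Cramer determinant of (★)₆ on every block `2d_S ≡ 6 (mod 8)`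

THEOREMS ONLY (no `def`, no named fact, no `sorry`), `--supports stmt-BirchSwinnertonDyer-20509` (the `s = 1`, `n ≡ 6 (8)` stratum of item 23432
`RamifiedOffJumpOneOfFacts`, and the even blocks of C⁺ = item 23431).  Sequel of `…MoverBlockFormSixOfValue` (regime-free block form on `Pic(𝒪₄)`) and
of g9's `…MoverSumBlocksSixBlocks` / `…MoverSumBlocksSix` (genus-regime versions).

* §1 `kerSum_six_inl_add_inr_all`: **the kernel line in census coordinates WITHOUT `#ker N_d = 2`** —
  `kerSum(N_d)_{inl x} + kerSum(N_d)_{inr} = det((A_d + D₋₂)[col x ← t_d])` for every block tuple: when the Frobenius rows are dependent both sides vanish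
  (a relation `w` with `wᵀ(A_d + D₋₂) = 0`, `w·z_d = 0` has `w·t_d = 0` by the row sums `(A_d + D₋₂)𝟙 = t_d + z_d`, so `w` kills the column-replaced matrix).
* §2 `kummer_chi_eq_cramer_six_all`: the block motion of the Kummer element `h` (fixing `i`, moving `i√−2` and `i√−pᵢ`) on an even block `2d_S ∋ pᵢ` is the
  Cramer determinant `det((L_S + D_{t+z})[col i ← t·1_S])` of (★)₆ — g9's `kummer_chi_eq_cramer_six` with `Odd (gK (2d_S))` and `#ker N = 2` REMOVED, the
  ring class dictionary `ρ₄` and the Frobenius classes (F4) of the block supplied instead (displays `RingClassFourBlockSpec`, `FrobeniusFourValueBlockSpec`).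
* §3 `sqMover_six_of_adjugate_eq_one_all`: **`adj(M_even)_{(inl i)(inr i)} = 1 ⟹ (hh)·P(n) ≠ P(n)`** for `n = 2p₁⋯p_k ≡ 6 (mod 8)` — g9's even block sum
  with the genus-regime hypothesis `hgenus` REMOVED (replaced by the displayed dictionaries and class values on every block `d ≡ 6 (mod 8)`).
BSD is not proved by any of this; no class is closed by this file.

References: [cite: TianYuanZhang2017, Thm. 1.1, §3.1 (p0011 L1–L73), Prop. 3.2 (2), Thm. 3.5, Thm. 3.6 (2), proof of Lemma 3.21 (p0020 L27–L63)];
[cite: HeathBrown1994SelmerCongruentII, Appendix (Monsky), typescript p. 39 L10 – p. 41 L36]; [cite: Smith2016CongruentDensity, Thm. 1.2, §2];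
[cite: Cox2013, §5.C Lemma 5.19, (5.22), Thm. 5.23, Cor. 5.25, §9.A]; [cite: HornJohnson2013, §0.8.2]; [cite: Stevenhagen1995RedeiMatrices, §2].
-/

noncomputable section

open scoped Classical NumberField

open WeierstrassCurve WeierstrassCurve.Affine Finset Matrix Literature.NumberTheory.EllipticCurves
  Literature.NumberTheory.EllipticCurves.TianYuanZhang2017
  Literature.NumberTheory.EllipticCurves.TianYuanZhang2017.W2
  Literature.NumberTheory.EllipticCurves.HeathBrown1994
  Literature.NumberTheory.EllipticCurves.HeathBrown1994.Families
  Literature.NumberTheory.EllipticCurves.Smith2016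
  Literature.NumberTheory.EllipticCurves.MonskySelmerParity
  Literature.NumberTheory.QuadraticFields.RingClass
  Literature.NumberTheory.QuadraticFields
  Literature.LinearAlgebra.Matrix
  Summit.BirchSwinnertonDyer.Rank1Residual.P2.GenusPeriodTransferLayer
  Summit.BirchSwinnertonDyer.Rank1Residual.P2.ThetaDescent
  Summit.BirchSwinnertonDyer.PrintCf2.QForm
  Summit.BirchSwinnertonDyer.PrintCf2.QFormForest

set_option autoImplicit false

namespace Summit.BirchSwinnertonDyer.PrintCf2.MoverAssembly

/-! ## §1 The kernel line in census coordinates, all regimes -/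

section KernelLineAll

variable {m : ℕ} (q : Fin m → ℕ) (hq : ∀ j, (q j).Prime) (hqodd : ∀ j, Odd (q j))

include hq hqodd in
/-- **THE KERNEL LINE OF `N_d` READ BY THE KUMMER BITS, ALL REGIMES.**  For a block tuple `q` (odd primes) with `N_d = [[A_d + D₋₂, z_d],[0,0]]`:
`kerSum(N_d)_{inl x} + kerSum(N_d)_{inr} = det((A_d + D₋₂)[col x ← t_d])`, `t_d = ((−1/q_j)₊)_j` — g9's `kerSum_six_inl_add_inr` WITHOUT `#ker N_d = 2`:
if `#ker N_d ≠ 2` then `kerSum = 0`, and a dependency `w ≠ 0` of the Frobenius rows (`wᵀ(A_d + D₋₂) = 0`, `w·z_d = 0`, hence `w·t_d = 0` by the row sums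
`(A_d+D₋₂)𝟙 = t_d + z_d`) kills the column-replaced matrix, whose determinant therefore vanishes.
[cite: HornJohnson2013, §0.8.2] [cite: HeathBrown1994SelmerCongruentII, Appendix (Monsky), typescript p. 41 L20–L36] [cite: Stevenhagen1995RedeiMatrices, §2] -/
theorem kerSum_six_inl_add_inr_all (x : Fin m) :
    kerSum (fromBlocks (legendreMatrix q + legendreDiagonal q (-2)) (Matrix.of fun j (_ : Unit) => addLegendreSym 2 (q j))
        (0 : Matrix Unit (Fin m) (ZMod 2)) (0 : Matrix Unit Unit (ZMod 2))) (Sum.inl x) +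
      kerSum (fromBlocks (legendreMatrix q + legendreDiagonal q (-2)) (Matrix.of fun j (_ : Unit) => addLegendreSym 2 (q j))
        (0 : Matrix Unit (Fin m) (ZMod 2)) (0 : Matrix Unit Unit (ZMod 2))) (Sum.inr ()) =
      ((legendreMatrix q + legendreDiagonal q (-2)).updateCol x (fun j => addLegendreSym (-1) (q j))).det := by
  set N := fromBlocks (legendreMatrix q + legendreDiagonal q (-2)) (Matrix.of fun j (_ : Unit) => addLegendreSym 2 (q j))
    (0 : Matrix Unit (Fin m) (ZMod 2)) (0 : Matrix Unit Unit (ZMod 2)) with hN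
  by_cases hcard : Fintype.card {v : Fin m ⊕ Unit → ZMod 2 // N *ᵥ v = 0} = 2
  · exact kerSum_six_inl_add_inr q hq hqodd hcard x
  · rw [kerSum_eq_zero_of_card_ne_two N hcard, Pi.zero_apply, Pi.zero_apply, add_zero]
    symm
    have hNrow : ∀ u, N (Sum.inr u) = 0 := fun u => by
      funext cc; rcases cc with i | u'
      · simp only [hN, Matrix.fromBlocks_apply₂₁, Matrix.zero_apply, Pi.zero_apply]
      · simp only [hN, Matrix.fromBlocks_apply₂₂, Matrix.zero_apply, Pi.zero_apply]
    obtain ⟨w, hw0, hw⟩ := exists_sum_smul_row_eq_zero N hNrow hcard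
    set B := legendreMatrix q + legendreDiagonal q (-2) with hB
    -- `wᵀ B = 0` and `w·z = 0`
    have hwB : w ᵥ* B = 0 := by
      funext i
      have h := congr_fun hw (Sum.inl i)
      rw [Finset.sum_apply, Pi.zero_apply] at h
      simp only [Pi.smul_apply, smul_eq_mul, hN, Matrix.fromBlocks_apply₁₁] at h
      rw [Pi.zero_apply, ← h, vecMul, dotProduct]
    have hwz : ∑ j, w j * addLegendreSym 2 (q j) = 0 := by
      have h := congr_fun hw (Sum.inr ())
      rw [Finset.sum_apply, Pi.zero_apply] at h
      simp only [Pi.smul_apply, smul_eq_mul, hN, Matrix.fromBlocks_apply₁₂, Matrix.of_apply] at h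
      exact h
    -- `w·t = 0` from the row sums `B𝟙 = t + z`
    have hwt : w ⬝ᵥ (fun j => addLegendreSym (-1) (q j)) = 0 := by
      have h1 : w ⬝ᵥ (B *ᵥ fun _ => (1 : ZMod 2)) = 0 := by rw [dotProduct_mulVec, hwB, zero_dotProduct]
      rw [hB, legendreMatrix_add_diagonal_mulVec_one q hq hqodd] at h1
      have h2 : w ⬝ᵥ (fun j => addLegendreSym (-1) (q j) + addLegendreSym 2 (q j)) =
          w ⬝ᵥ (fun j => addLegendreSym (-1) (q j)) + ∑ j, w j * addLegendreSym 2 (q j) := by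
        rw [show (fun j => addLegendreSym (-1) (q j) + addLegendreSym 2 (q j)) =
          (fun j => addLegendreSym (-1) (q j)) + (fun j => addLegendreSym 2 (q j)) from rfl, dotProduct_add]
        rfl
      rw [h2, hwz, add_zero] at h1
      exact h1
    -- `w` kills the column-replaced matrix
    have hker : w ᵥ* (B.updateCol x (fun j => addLegendreSym (-1) (q j))) = 0 := by
      funext i
      rw [vecMul, dotProduct, Pi.zero_apply]
      by_cases hix : i = x
      · subst hix
        simp only [updateCol_self]
        exact hwt
      · simp only [updateCol_ne hix]
        have := congr_fun hwB i
        rw [vecMul, dotProduct, Pi.zero_apply] at this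
        exact this
    exact Matrix.exists_vecMul_eq_zero_iff.mp ⟨w, hw0, hker⟩

end KernelLineAll

/-! ## §2 The Kummer block motion on an even block is the Cramer determinant — no genus regime -/

section Blocks

variable {k : ℕ} (p : Fin k → ℕ) (hp : ∀ i, (p i).Prime) (hodd : ∀ i, Odd (p i)) (hinj : Function.Injective p)
variable {n : ℕ} (D : GenusPointData n)

include hp hodd hinj in
/-- **The block motion of the Kummer element on an even block `2d_S ∋ pᵢ` is the Cramer determinant of (★)₆, IN EVERY REGIME**:
`[(hh)^{g(d)}σ⁻¹ ∈ Gal(ℍ′_n/H′_d)] = det((L_S + D_{t+z})[col i ← t·1_S])` — g9's `kummer_chi_eq_cramer_six` with `Odd (gK d)` and `#ker N_d = 2` removed; the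
block carries its ring class dictionary `ρ₄` (`RingClassFourBlockSpec`) and the Frobenius elements of its odd primes with their classes
(`FrobeniusFourValueBlockSpec`) instead.  Regime-free block law (`sqMotion_eq_kerSum_dotProduct_bits_six_of_value`) with the bit vector `e_{pᵢ} + e_2`,
then the regime-free kernel line (`kerSum_six_inl_add_inr_all`) and the census dictionary (p707948).
[cite: TianYuanZhang2017, §3.1 (p0011 L53–L64), Prop. 3.2 (2), Thm. 3.6 (2), proof of Lemma 3.21 (p0020 L50–L63)]
[cite: Cox2013, §5.C Lemma 5.19, Thm. 5.23, Cor. 5.25, §9.A] [cite: HeathBrown1994SelmerCongruentII, Appendix (Monsky), typescript p. 41 L20–L36] -/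
theorem kummer_chi_eq_cramer_six_all (hn : n = 2 * ∏ i, p i) {h : D.H ≃ₐ[ℚ] D.H} (hhi : h D.im = D.im)
    (hh2 : h (D.im * D.sqrtNeg 2) ≠ D.im * D.sqrtNeg 2) {i : Fin k}
    (hhp : ∀ j, h (D.im * D.sqrtNeg (p j)) = D.im * D.sqrtNeg (p j) ↔ j ≠ i)
    (S : Finset (Fin k)) (hiS : i ∈ S) (hS : (∑ j ∈ S, addLegendreSym (-1) (p j)) = 1)
    {z : APoint D.H} {Φ : Finset (D.H ≃ₐ[ℚ] D.H)} {ΓH ΓH' : Subgroup (D.H ≃ₐ[ℚ] D.H)} {σ θ c : D.H ≃ₐ[ℚ] D.H}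
    (hCM : D.CMBlockSpec (2 * ∏ j ∈ S, p j) z Φ ΓH ΓH' σ c)
    (hθd : θ (D.sqrtNeg (2 * ∏ j ∈ S, p j)) = D.sqrtNeg (2 * ∏ j ∈ S, p j)) (hθ : θ * θ * σ⁻¹ ∈ ΓH')
    {ρ : D.galK (2 * ∏ j ∈ S, p j) →* RingClassGroup (GenusField (2 * ∏ j ∈ S, p j)) 4}
    (hRC : D.RingClassFourBlockSpec (2 * ∏ j ∈ S, p j) ΓH ΓH' ρ) (hV : D.FrobeniusFourValueBlockSpec (2 * ∏ j ∈ S, p j) ΓH' ρ) :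
    (if (h * h) ^ gK (2 * ∏ j ∈ S, p j) * σ⁻¹ ∈ ΓH' then (1 : ZMod 2) else 0) =
      ((lap (fun i j => legendreMatrix p i j) S (fun j => addLegendreSym (-1) (p j) + addLegendreSym 2 (p j))).updateCol i
          (fun r => if r ∈ S then addLegendreSym (-1) (p r) else 0)).det := by
  have hp2 : ∀ i, p i ≠ 2 := ne_two_of_odd p hodd
  have hsq : Squarefree n := by
    rw [hn, ← prod_cons_two_eq p]
    exact squarefree_prod_of_injective _ (prime_cons_two p hp) (injective_cons_two p hodd hinj)
  have hdS := twice_blockProd_mem_divisors p hp hn S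
  set q : Fin S.card → ℕ := blockPrimes p S with hq
  have hqprod : 2 * ∏ t, q t = 2 * ∏ j ∈ S, p j := by rw [prod_blockPrimes]
  -- `d ≡ 6 (mod 8)`: `d_S ≡ 3 (mod 4)`
  have hS4 : (∏ j ∈ S, p j) % 4 = 3 := (blockProd_mod_four_of_sum p hp hodd S).1 hS
  have hd8 : (2 * ∏ j ∈ S, p j) % 8 = 6 := by omega
  have hfix : h (D.sqrtNeg (2 * ∏ j ∈ S, p j)) = D.sqrtNeg (2 * ∏ j ∈ S, p j) :=
    (kummer_apply_sqrtNeg_even_iff p hp D hn hhi hh2 hhp S).mpr hiS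
  rw [sqMotion_eq_kerSum_dotProduct_bits_six_of_value D q (blockPrimes_prime p hp S) (blockPrimes_odd p hodd S) (blockPrimes_injective p hinj S)
    hsq hdS hd8 hqprod hCM hθd hθ hRC hV h hfix]
  -- the bit vector is `e_{e⁻¹ i} + e_inr`
  set e := (S.orderIsoOfFin rfl).toEquiv with he
  have hbits_inl : ∀ t : Fin S.card, (if h (D.im * D.sqrtNeg (q t)) = D.im * D.sqrtNeg (q t) then (0 : ZMod 2) else 1) =
      if t = e.symm ⟨i, hiS⟩ then 1 else 0 := by
    intro t
    have ht : h (D.im * D.sqrtNeg (q t)) = D.im * D.sqrtNeg (q t) ↔ ¬ t = e.symm ⟨i, hiS⟩ := by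
      rw [hq, blockPrimes_apply, hhp]
      constructor
      · intro hne hte; apply hne; rw [hte]; simp [he]
      · intro hne hte; apply hne; apply e.injective; rw [Equiv.apply_symm_apply]; exact Subtype.ext hte
    by_cases ht' : t = e.symm ⟨i, hiS⟩
    · rw [if_pos ht', if_neg (fun hh => (ht.mp hh) ht')]
    · rw [if_neg ht', if_pos (ht.mpr ht')]
  rw [Fintype.sum_sum_type]
  simp only [Sum.elim_inl, Sum.elim_inr, hbits_inl, if_neg hh2, mul_ite, mul_one, mul_zero, Finset.sum_ite_eq', Finset.mem_univ,
    if_true, univ_unique, sum_singleton]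
  exact (kerSum_six_inl_add_inr_all q (blockPrimes_prime p hp S) (blockPrimes_odd p hodd S) _).trans
    (det_updateCol_lap_eq_det_updateCol_block p hp hp2 hiS).symm

/-! ## §3 The even block sum without the genus regime -/

include hp hodd hinj in
/-- **THE EVEN BLOCK SUM, ALL REGIMES.**  `n = 2p₁⋯p_k ≡ 6 (mod 8)` (`p₁⋯p_k ≡ 3 (mod 4)`), displayed CM-point layer on every block, the lift `θ_d`
of `σ_{1+ϖ}`, the ring class dictionary `ρ₄` and the Frobenius classes (F4) on every block `d ≡ 6 (mod 8)` (`RingClassFourBlockSpec`,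
`FrobeniusFourValueBlockSpec`), TYZ Thm 1.1; `h` the Kummer element pointed at `pᵢ`.  If `adj(M_even)_{(inl i)(inr i)} = 1` then `(hh)·P(n) ≠ P(n)` — g9's
`sqMover_six_of_adjugate_eq_one` WITHOUT the genus-regime hypothesis: the `τ(1)`-coefficient of `(hh)·P(n) − P(n)` reduces to
`ι(n) + Σ_{d∈R(n)} ℓ(n/d) ι(d)`, odd blocks vanish, every even block `2d_S ∋ pᵢ` IS its Cramer determinant (`kummer_chi_eq_cramer_six_all`) weighted by
`coblockWeight p S`, and the sum is `adj(M_even)_{(inl i)(inr i)}` by (★)₆.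
[cite: TianYuanZhang2017, Thm. 1.1, §3.1 (p0011 L53–L73), Prop. 3.2 (2), Thm. 3.6 (2), proof of Lemma 3.21 (p0020 L27–L63)]
[cite: HeathBrown1994SelmerCongruentII, Appendix (Monsky), typescript p. 41 L20–L36] [cite: Cox2013, §5.C Lemma 5.19, Thm. 5.23, Cor. 5.25, §9.A] -/
theorem sqMover_six_of_adjugate_eq_one_all (hn : n = 2 * ∏ i, p i) (h3 : (∏ i, p i) % 4 = 3) (hrec : D.recursion) (hLs : D.scriptLSpec)
    (z : ℕ → APoint D.H) (Φ : ℕ → Finset (D.H ≃ₐ[ℚ] D.H)) (ΓH ΓH' : ℕ → Subgroup (D.H ≃ₐ[ℚ] D.H))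
    (σ θ : ℕ → (D.H ≃ₐ[ℚ] D.H)) (c : D.H ≃ₐ[ℚ] D.H) (hc : D.ConjSpec c)
    (ρ₄ : (d : ℕ) → (D.galK d →* RingClassGroup (GenusField d) 4))
    (hblock : ∀ d ∈ n.divisors, ((d % 8 = 5 ∨ d % 8 = 6) → D.CMBlockSpec d (z d) (Φ d) (ΓH d) (ΓH' d) (σ d) c) ∧
      (d % 8 = 7 → D.SevenBlockSpec d))
    (htheta : ∀ d ∈ n.divisors, d % 8 = 6 → D.ThetaBlockSpec d (z d) (ΓH d) (ΓH' d) (σ d) (θ d))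
    (hring : ∀ d ∈ n.divisors, d % 8 = 6 → D.RingClassFourBlockSpec d (ΓH d) (ΓH' d) (ρ₄ d))
    (hval : ∀ d ∈ n.divisors, d % 8 = 6 → D.FrobeniusFourValueBlockSpec d (ΓH' d) (ρ₄ d))
    (h11 : thm11_parity_of_scriptL) (i : Fin k)
    {h : D.H ≃ₐ[ℚ] D.H} (hhi : h D.im = D.im) (hh2 : h (D.im * D.sqrtNeg 2) ≠ D.im * D.sqrtNeg 2)
    (hhp : ∀ j, h (D.im * D.sqrtNeg (p j)) = D.im * D.sqrtNeg (p j) ↔ j ≠ i)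
    (hadj : (monskyMatrixEven p).adjugate (Sum.inl i) (Sum.inr i) = 1) :
    D.galPt (h * h) (D.P n) ≠ D.P n := by
  have hp2 : ∀ i, p i ≠ 2 := ne_two_of_odd p hodd
  have hsq : Squarefree n := by
    rw [hn, ← prod_cons_two_eq p]
    exact squarefree_prod_of_injective _ (prime_cons_two p hp) (injective_cons_two p hodd hinj)
  have hn0 : n ≠ 0 := hsq.ne_zero
  have hnn : n ∈ n.divisors := Nat.mem_divisors_self n hn0
  have hmodd : Odd (∏ i, p i) := odd_prod p hp hp2
  have h6 : n % 8 = 6 := by rcases hmodd with ⟨r, hr⟩; omega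
  have ht1 : (∑ j, addLegendreSym (-1) (p j)) = 1 := by rw [sum_addLegendreSym_neg_one_eq p hp hp2, if_neg (by omega)]
  -- the `𝔽₂`-valued block motion and weight
  set ι : ℕ → ZMod 2 := fun d =>
    if (d % 8 = 5 ∨ d % 8 = 6) ∧ h (D.sqrtNeg d) = D.sqrtNeg d ∧ (h * h) ^ gK d * (σ d)⁻¹ ∈ ΓH' d then 1 else 0 with hι
  set ℓ : ℕ → ZMod 2 := fun x => (((D.scriptL x).natAbs : ℕ) : ZMod 2) with hℓ
  -- odd blocks carry no motion
  have hιodd : ∀ d ∈ n.divisors, Odd d → ι d = 0 := fun d hd hdo =>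
    kummer_blockMotion_eq_zero_of_odd p hp hodd hinj D hn z Φ ΓH ΓH' σ c hblock hhi hhp hd hdo
  have hι5 : ∀ d ∈ n.divisors, d % 8 = 5 → ι d = 0 := fun d hd hd5 =>
    hιodd d hd (Nat.odd_iff.mpr (by omega))
  rw [galPt_mul_self_P_ne_iff_even D hsq h6 hrec z Φ ΓH ΓH' σ c hc hblock h, odd_iff_natCast_zmod_two_eq_one]
  push_cast
  -- fold the casts into `ι`, `ℓ`
  have hfold : ∀ d, ((if (d % 8 = 5 ∨ d % 8 = 6) ∧ h (D.sqrtNeg d) = D.sqrtNeg d ∧ (h * h) ^ gK d * (σ d)⁻¹ ∈ ΓH' d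
      then (1 : ZMod 2) else 0)) = ι d := fun d => rfl
  simp only [hfold]
  -- the chains through blocks `≡ 5 (mod 8)` vanish (odd blocks)
  have hdiv_of_rec : ∀ {e d : ℕ}, e ∈ n.divisors → d ∈ recursionIndex e → d ∈ n.divisors := by
    intro e d he hd
    obtain ⟨hde, -, -, -⟩ := mem_recursionIndex_iff.mp hd
    exact Nat.divisors_subset_of_dvd hn0 (Nat.dvd_of_mem_divisors he) hde
  have h3sum : ∑ d ∈ recursionIndex n, ∑ d' ∈ (recursionIndex d).filter (fun d' => d' % 8 = 5),
      ℓ (n / d) * ℓ (d / d') * ι d' = 0 := by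
    refine Finset.sum_eq_zero fun d hd => Finset.sum_eq_zero fun d' hd' => ?_
    obtain ⟨hd'R, hd'5⟩ := mem_filter.mp hd'
    rw [hι5 d' (hdiv_of_rec (hdiv_of_rec hnn hd) hd'R) hd'5, mul_zero]
  have h4sum : ∑ d ∈ (recursionIndex n).filter (fun d => d % 2 = 0), ∑ d' ∈ recursionIndex d,
      ∑ e ∈ (recursionIndex d').filter (fun e => e % 8 = 5), ℓ (n / d) * ℓ (d / d') * ℓ (d' / e) * ι e = 0 := by
    refine Finset.sum_eq_zero fun d hd => Finset.sum_eq_zero fun d' hd' => Finset.sum_eq_zero fun e he => ?_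
    obtain ⟨hdR, -⟩ := mem_filter.mp hd
    obtain ⟨heR, he5⟩ := mem_filter.mp he
    rw [hι5 e (hdiv_of_rec (hdiv_of_rec (hdiv_of_rec hnn hdR) hd') heR) he5, mul_zero]
  rw [h3sum, h4sum, add_zero, add_zero]
  -- the main sum as a sum over all divisors
  set F : ℕ → ZMod 2 := fun d => (if d = n then 1 else if d ∈ recursionIndex n then ℓ (n / d) else 0) * ι d with hF
  have hmain : ι n + ∑ d ∈ recursionIndex n, ℓ (n / d) * ι d = ∑ d ∈ n.divisors, F d := by
    rw [← Finset.add_sum_erase _ _ hnn]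
    congr 1
    · simp only [hF, if_true, one_mul]
    · have hsub : recursionIndex n ⊆ n.divisors.erase n := by
        intro d hd
        refine mem_erase.mpr ⟨(lt_of_mem_recursionIndex hd).ne, (mem_recursionIndex_iff.mp hd).1⟩
      rw [← Finset.sum_subset hsub]
      · refine Finset.sum_congr rfl fun d hd => ?_
        simp only [hF, if_neg (lt_of_mem_recursionIndex hd).ne, if_pos hd]
      · intro d hd hdn
        obtain ⟨hne, -⟩ := mem_erase.mp hd
        simp only [hF, if_neg hne, if_neg hdn, zero_mul]
  rw [hmain, sum_divisors_two_mul p hp hodd hinj hn F]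
  -- odd divisors contribute nothing
  have hoddpart : (∑ S : Finset (Fin k), F (∏ j ∈ S, p j)) = 0 := by
    refine Finset.sum_eq_zero fun S _ => ?_
    have hdS : (∏ j ∈ S, p j) ∈ n.divisors := by
      rw [hn]
      exact Nat.mem_divisors.mpr ⟨Dvd.dvd.mul_left (Finset.prod_dvd_prod_of_subset _ _ _ (subset_univ S)) 2,
        mul_ne_zero two_ne_zero hmodd.pos.ne'⟩
    have hoS : Odd (∏ j ∈ S, p j) := by
      rw [← prod_blockPrimes]; exact odd_prod _ (blockPrimes_prime p hp S) (ne_two_of_odd _ (blockPrimes_odd p hodd S))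
    simp only [hF]
    rw [hιodd _ hdS hoS, mul_zero]
  rw [hoddpart, zero_add]
  -- even divisors: the (★)₆ sum
  rw [adjugate_monskyMatrixEven_inl_inr_eq_sum_filter p hp hp2 hinj ht1 i] at hadj
  rw [← hadj, sum_filter, ← Finset.powerset_univ]
  refine Finset.sum_congr rfl fun S _ => ?_
  have hdS := twice_blockProd_mem_divisors p hp hn S
  by_cases hiS : i ∈ S
  swap
  · -- `i ∉ S`: `h` moves `√−2d_S`
    have hmv : ¬ h (D.sqrtNeg (2 * ∏ j ∈ S, p j)) = D.sqrtNeg (2 * ∏ j ∈ S, p j) :=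
      fun hf => hiS ((kummer_apply_sqrtNeg_even_iff p hp D hn hhi hh2 hhp S).mp hf)
    have hι0 : ι (2 * ∏ j ∈ S, p j) = 0 := by simp only [hι]; rw [if_neg (fun hh => hmv hh.2.1)]
    simp only [hF]
    rw [hι0, mul_zero, if_neg (fun hh => hiS hh.1)]
  by_cases hS : (∑ j ∈ S, addLegendreSym (-1) (p j)) = 1
  swap
  · -- even block sign `d_S ≡ 1 (mod 4)`: `2d_S ≡ 2 (mod 8)` is not a block
    have hS0 : (∑ j ∈ S, addLegendreSym (-1) (p j)) = 0 := by
      have h01 : ∀ u : ZMod 2, u ≠ 1 → u = 0 := by decide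
      exact h01 _ hS
    have h4' := (blockProd_mod_four_of_sum p hp hodd S).2 hS0
    have hι0 : ι (2 * ∏ j ∈ S, p j) = 0 := by
      simp only [hι]; rw [if_neg]; rintro ⟨h56, -, -⟩; omega
    simp only [hF]
    rw [hι0, mul_zero, if_neg (fun hh => hS hh.2)]
  rw [if_pos ⟨hiS, hS⟩]
  have hS4 := (blockProd_mod_four_of_sum p hp hodd S).1 hS
  have hd8 : (2 * ∏ j ∈ S, p j) % 8 = 6 := by omega
  have hfix : h (D.sqrtNeg (2 * ∏ j ∈ S, p j)) = D.sqrtNeg (2 * ∏ j ∈ S, p j) :=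
    (kummer_apply_sqrtNeg_even_iff p hp D hn hhi hh2 hhp S).mpr hiS
  -- the block motion IS the Cramer determinant (all regimes)
  have hmotion : ι (2 * ∏ j ∈ S, p j) =
      ((lap (fun i j => legendreMatrix p i j) S (fun j => addLegendreSym (-1) (p j) + addLegendreSym 2 (p j))).updateCol i
        (fun r => if r ∈ S then addLegendreSym (-1) (p r) else 0)).det := by
    obtain ⟨hθd, -, -, hθ⟩ := htheta _ hdS hd8
    simp only [hι]
    rw [← kummer_chi_eq_cramer_six_all p hp hodd hinj D hn hhi hh2 hhp S hiS hS ((hblock _ hdS).1 (Or.inr hd8)) hθd hθ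
      (hring _ hdS hd8) (hval _ hdS hd8)]
    by_cases hm : (h * h) ^ gK (2 * ∏ j ∈ S, p j) * (σ (2 * ∏ j ∈ S, p j))⁻¹ ∈ ΓH' (2 * ∏ j ∈ S, p j)
    · rw [if_pos ⟨Or.inr hd8, hfix, hm⟩, if_pos hm]
    · rw [if_neg (fun hh => hm hh.2.2), if_neg hm]
  by_cases hSu : S = univ
  · -- the full block `d = n`
    subst hSu
    have hdn : 2 * ∏ j ∈ (univ : Finset (Fin k)), p j = n := by rw [hn]
    simp only [hF]
    rw [if_pos hdn, one_mul, coblockWeight_univ, mul_one, hmotion]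
  -- a proper even block
  have hdn : 2 * ∏ j ∈ S, p j ≠ n := by
    intro he
    apply hSu
    apply eq_univ_of_blockProd_eq p hp hinj S
    have : 2 * ∏ j ∈ S, p j = 2 * ∏ i, p i := by rw [he, hn]
    omega
  have hquot : n / (2 * ∏ j ∈ S, p j) = ∏ j ∈ Sᶜ, p j := div_twice_blockProd p hp hn S
  simp only [hF]
  rw [if_neg hdn]
  rcases cofactor_mod_eight_of_three p hp hodd h3 S hS4 with hc1 | hc5
  · -- cofactor `≡ 1 (mod 8)`: a block of the recursion, weight `= coblockWeight`
    have hne : Sᶜ.Nonempty := by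
      rw [Finset.nonempty_iff_ne_empty, Ne, Finset.compl_eq_empty_iff]; exact hSu
    have hgt : 1 < ∏ j ∈ Sᶜ, p j := by
      obtain ⟨j, hj⟩ := hne
      rw [← Finset.mul_prod_erase _ _ hj]
      have h1 := (hp j).one_lt
      have h2 := blockProd_pos p hp (Sᶜ.erase j)
      nlinarith
    have hmemR : 2 * ∏ j ∈ S, p j ∈ recursionIndex n := by
      rw [mem_recursionIndex_iff, hquot]
      exact ⟨hdS, Or.inr (Or.inl hd8), Or.inl hc1, hgt⟩
    rw [if_pos hmemR, hℓ]
    dsimp only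
    rw [scriptL_parity_eq_coblockWeight_six p hp hodd hinj D h11 hn hLs S hSu hc1, hmotion]
    rcases (by decide : ∀ u : ZMod 2, u = 0 ∨ u = 1) (coblockWeight p S) with hw | hw
    · rw [hw, zero_mul, mul_zero]
    · rw [hw, one_mul, mul_one]
  · -- cofactor `≡ 5 (mod 8)`: not a block of the recursion, and weight `0`
    have hnotR : 2 * ∏ j ∈ S, p j ∉ recursionIndex n := by
      intro hm
      obtain ⟨-, -, h123, -⟩ := mem_recursionIndex_iff.mp hm
      rw [hquot] at h123
      omega
    rw [if_neg hnotR, zero_mul, coblockWeight_eq_zero_of_cofactor_five p hp hodd hinj S hc5, mul_zero]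

end Blocks

end Summit.BirchSwinnertonDyer.PrintCf2.MoverAssembly

end
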